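import Summits.QuantumFields.YangMills.Theorems.PoincareLipschitzLinAvgCurlEll2
import HarnessLib

/-!
# Line «poincare_lipschitz» on crux `HistoryTailL` (stmt-QuantumFields-19936), route crux `BlockLipschitzL` (stmt-QuantumFields-23533), K2 AT DEPTH —
# THE CURL OF THE `k`-FOLD (0.4) LINEAR AVERAGE IN CLOSED FORM: a UNIFORM MEAN of the level-0 curl over the `(L^k)^d` translated `L^k × L^k` squares;
# hence a height-`k` small-field window is a bound on the MEAN level-0 curl by `(window)·(L^k)^{−2}`

Cell `ym3-torus` (YM ladder rung R3 = continuum SU(2) Yang–Mills on the three-torus — a RUNG, NOT the Clay problem: not d = 4, not infinite volume, not a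
mass gap); width seat `ym3-torus-px7` gen 4, LOCATE «(R3)-LIN» (19936 evidence #44) item (B).  LINEAR MODEL ONLY; route-independent imports
(✓`PoincareLipschitzLinAvgCurlEll2`); def-free; `--supports stmt-QuantumFields-23533`.  Nothing here proves `hStab`, (R1)–(R4), a stub, `BlockLipschitzL`,
`HistoryTailL` or a summit statement.

WHY.  LEAD ym-ust-19936-w1 g7's card v1.25 (c) names (R3) INTERIOR REGULARITY («U-div-free ∧ curl-small, BOTH FIELDS GOOD ⇒ sup_{footprint}|X| ≲
(L^{j+1})^{−3/2}‖X‖_{ℓ²} + O(θ)») and (R4) («j-UNIFORM through the closed form of the iterate, NOT per step»).  In the linear model «good at height `k`» is a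
window `|curlAt (linAvgIter k X) Y μ ν| < 2θ_k` on the curl of the `k`-fold (0.4) linear average, and the LOCATE shows that (R3)'s «+O(θ)» is reachable ONLY by
using these windows at EVERY height — read as bounds on MEANS of the level-0 curl `F = curlAt X`, which decay like `θ_k·(L^k)^{−2} = θ₀·L^{−3k/2}·π_k`.  The
identity that turns a window into such a mean was so far a `have` inside the proof of ✓`PoincareLipschitzLinAvgEll2.abs_curlAt_linAvgIter_le_sqrt` (p674417).
THIS FILE exports it, with the lattice Stokes formula of ✓`AbelianEML.rectSum_eq_sum_curl` applied to the translated squares: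

* `tubeSum_eq_sum_runSum`, `bsite_shift` (bookkeeping: the tube sum is a sum of straight run sums; a unit coarse shift moves the block corners by `L^k`);
* ★ `tubeSum_boundary_eq_sum_rectSum` — the four tube sums around the level-`k` plaquette `(Y; μ, ν)` are the sum over the offsets `r` of the fluxes
  `rectSum X (bsite k Y r) μ ν L^k L^k` around the translated `L^k × L^k` squares;
* ★★ `curlAt_linAvgIter_eq_sum_rectSum` — `curlAt (linAvgIter k X) Y μ ν = (L^k)^{−d}·Σ_r rectSum X (bsite k Y r) μ ν L^k L^k` (closed form
  ✓`AbelianEML.linAvgIter_eq_tubeSum_sub_cobd`; the coboundary has no curl);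
* ★★ `curlAt_linAvgIter_eq_sum_curlAt` — `… = (L^k)^{−d}·Σ_r Σ_{t<L^k} Σ_{s<L^k} curlAt X (bsite k Y r + t e_ν + s e_μ) μ ν` (Stokes): the curl of the
  iterate IS `(L^k)²` times the uniform mean of the level-0 curl over the `(L^k)^d·(L^k)²` plaquettes of the translated-square family;
* ★ `abs_curlAt_linAvgIter_le_of_fine` — a pointwise level-0 bound `|curlAt X| ≤ B` on those plaquettes gives `|curlAt (linAvgIter k X)| ≤ (L^k)²·B`
  (so a constant curl `θ₀` violates the height-`k` window `2θ₀L^{k/2}π_k` as soon as `L^{3k/2} > 2π_k`: the windows are genuinely multi-scale);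
* ★ `abs_mean_curlAt_le_of_window` — conversely a height-`k` window `|curlAt (linAvgIter k X) Y μ ν| ≤ c` says the MEAN of the level-0 curl over the family
  is `≤ c·(L^k)^{−2}` in absolute value.
[folklore] bookkeeping over [Balaban1987RG1] (0.4)/(0.11) p.253 and [Balaban1985Averaging] (9) p.19; no analysis.
-/

set_option autoImplicit false

noncomputable section

namespace Summit.QuantumFields.YangMills.Theorems.PoincareLipschitzLinAvgCurlClosedForm

open scoped BigOperators
open Literature.MathematicalPhysics.QuantumFieldTheory.Balaban1983to89
open Literature.MathematicalPhysics.QuantumFieldTheory.Balaban1983to89.BlockAveragingEMLProp2 (shift_shift_comm)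
open Literature.MathematicalPhysics.QuantumFieldTheory.Balaban1983to89.B10Eq47AxialChi (shiftN shiftN_zero shiftN_succ)
open Summit.QuantumFields.YangMills.Theorems.AbelianEML
  (linAvgIter tubeSum bsite cobd curlAt runSum rectSum rectSum_eq_runSum rectSum_eq_sum_curl abs_rectSum_le linAvgIter_eq_tubeSum_sub_cobd
    bsite_shiftN)

variable {P : Params} {k : ℕ}

/-! ## §1 Bookkeeping: tube sums are sums of run sums; coarse unit shifts move block corners by `L^k` -/

/-- The tube sum at the level-`k` bond `(X, κ)` is the sum over the block offsets of the straight run sums of length `L^k`. [folklore] -/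
theorem tubeSum_eq_sum_runSum (a : PBond P 0 → ℝ) (X : Site P k) (κ : Fin P.d) :
    tubeSum k a ⟨X, κ⟩ = ∑ r : Fin P.d → Fin (P.L ^ k), runSum a (bsite k X r) κ (P.L ^ k) := by
  unfold tubeSum
  refine Finset.sum_congr rfl fun r _ => ?_
  rw [runSum, ← Fin.sum_univ_eq_sum_range (fun t => a ⟨shiftN (bsite k X r) κ t, κ⟩) (P.L ^ k)]

/-- A unit coarse shift of `Y` moves the block corner `bsite k Y r` by `L^k` finest steps (standing range). [folklore] -/
theorem bsite_shift (hk : k ≤ P.m + P.K) (Y : Site P k) (μ : Fin P.d) (r : Fin P.d → Fin (P.L ^ k)) :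
    bsite k (Y.shift μ) r = shiftN (bsite k Y r) μ (P.L ^ k) := by
  have h : Y.shift μ = shiftN Y μ 1 := by rw [shiftN_succ, shiftN_zero]
  rw [h, bsite_shiftN hk, one_mul]

/-! ## §2 The closed form of the curl of the iterate -/

/-- ★ **THE FOUR TUBE SUMS AROUND A COARSE PLAQUETTE ARE THE FLUXES AROUND THE TRANSLATED SQUARES**:
`tubeSum⟨Y,μ⟩ + tubeSum⟨Y+e_μ,ν⟩ − tubeSum⟨Y+e_ν,μ⟩ − tubeSum⟨Y,ν⟩ = Σ_r rectSum X (bsite k Y r) μ ν L^k L^k`. [cite: Balaban1987RG1, (0.4)+(0.11) p.253] -/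
theorem tubeSum_boundary_eq_sum_rectSum (hk : k ≤ P.m + P.K) (a : PBond P 0 → ℝ) (Y : Site P k) (μ ν : Fin P.d) :
    tubeSum k a ⟨Y, μ⟩ + tubeSum k a ⟨Y.shift μ, ν⟩ - tubeSum k a ⟨Y.shift ν, μ⟩ - tubeSum k a ⟨Y, ν⟩ =
      ∑ r : Fin P.d → Fin (P.L ^ k), rectSum a (bsite k Y r) μ ν (P.L ^ k) (P.L ^ k) := by
  simp only [tubeSum_eq_sum_runSum, bsite_shift hk, rectSum_eq_runSum, Finset.sum_add_distrib, Finset.sum_sub_distrib]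

/-- ★★ **THE CURL OF THE `k`-FOLD (0.4) LINEAR AVERAGE IN CLOSED FORM**: `curlAt (linAvgIter k X) Y μ ν = (L^k)^{−d}·Σ_r rectSum X (bsite k Y r) μ ν L^k L^k`
(the coboundary of ✓`linAvgIter_eq_tubeSum_sub_cobd` has no curl). [cite: Balaban1987RG1, (0.4)+(0.11) p.253] -/
theorem curlAt_linAvgIter_eq_sum_rectSum (hk : k ≤ P.m + P.K) (a : PBond P 0 → ℝ) (Y : Site P k) (μ ν : Fin P.d) :
    curlAt (linAvgIter k a) Y μ ν =
      (((P.L : ℝ) ^ k) ^ P.d)⁻¹ * ∑ r : Fin P.d → Fin (P.L ^ k), rectSum a (bsite k Y r) μ ν (P.L ^ k) (P.L ^ k) := by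
  obtain ⟨Φ, hΦ⟩ := linAvgIter_eq_tubeSum_sub_cobd hk a
  rw [← tubeSum_boundary_eq_sum_rectSum hk]
  simp only [curlAt, hΦ, cobd, PBond.tgt]
  rw [shift_shift_comm Y μ ν]
  ring

/-- ★★ **… AND BY STOKES A UNIFORM MEAN OF THE LEVEL-0 CURL**: `curlAt (linAvgIter k X) Y μ ν =
(L^k)^{−d}·Σ_r Σ_{t<L^k} Σ_{s<L^k} curlAt X (bsite k Y r + t e_ν + s e_μ) μ ν` — `(L^k)²` times the mean of the level-0 curl over the
`(L^k)^d·(L^k)²` plaquettes of the translated-square family. [cite: Balaban1985Averaging, (9) p.19; Balaban1987RG1, (0.11) p.253] -/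
theorem curlAt_linAvgIter_eq_sum_curlAt (hk : k ≤ P.m + P.K) (a : PBond P 0 → ℝ) (Y : Site P k) (μ ν : Fin P.d) :
    curlAt (linAvgIter k a) Y μ ν =
      (((P.L : ℝ) ^ k) ^ P.d)⁻¹ * ∑ r : Fin P.d → Fin (P.L ^ k), ∑ t ∈ Finset.range (P.L ^ k), ∑ s ∈ Finset.range (P.L ^ k),
        curlAt a (shiftN (shiftN (bsite k Y r) ν t) μ s) μ ν := by
  rw [curlAt_linAvgIter_eq_sum_rectSum hk]
  congr 1
  exact Finset.sum_congr rfl fun r _ => rectSum_eq_sum_curl a (bsite k Y r) μ ν (P.L ^ k) (P.L ^ k)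

/-- The same identity cleared of the denominator: `Σ_r Σ_t Σ_s curlAt X (…) μ ν = (L^k)^d · curlAt (linAvgIter k X) Y μ ν`. [folklore] -/
theorem sum_curlAt_eq_mul_curlAt_linAvgIter (hk : k ≤ P.m + P.K) (a : PBond P 0 → ℝ) (Y : Site P k) (μ ν : Fin P.d) :
    ∑ r : Fin P.d → Fin (P.L ^ k), ∑ t ∈ Finset.range (P.L ^ k), ∑ s ∈ Finset.range (P.L ^ k),
        curlAt a (shiftN (shiftN (bsite k Y r) ν t) μ s) μ ν =
      ((P.L : ℝ) ^ k) ^ P.d * curlAt (linAvgIter k a) Y μ ν := by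
  have hLd : (((P.L : ℝ) ^ k) ^ P.d) ≠ 0 := by
    have hL0 : (0 : ℝ) < P.L := by exact_mod_cast P.L_pos
    positivity
  rw [curlAt_linAvgIter_eq_sum_curlAt hk, ← mul_assoc, mul_inv_cancel₀ hLd, one_mul]

/-! ## §3 Windows versus means -/

/-- ★ **A POINTWISE LEVEL-0 BOUND GIVES `(L^k)²` AT HEIGHT `k`**: if `|curlAt X| ≤ B` on the plaquettes of the translated squares, then
`|curlAt (linAvgIter k X) Y μ ν| ≤ (L^k)²·B` (✓`abs_rectSum_le` square by square; the mean over the `(L^k)^d` offsets).  So a constant curl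
`θ₀` violates a height-`k` window of size `2θ₀L^{k/2}π_k` once `L^{3k/2} > 2π_k`: the hierarchical windows are multi-scale information. [folklore] -/
theorem abs_curlAt_linAvgIter_le_of_fine (hk : k ≤ P.m + P.K) (a : PBond P 0 → ℝ) (Y : Site P k) (μ ν : Fin P.d) {B : ℝ}
    (hB : ∀ (r : Fin P.d → Fin (P.L ^ k)) (s t : ℕ), s < P.L ^ k → t < P.L ^ k →
      |curlAt a (shiftN (shiftN (bsite k Y r) ν t) μ s) μ ν| ≤ B) :
    |curlAt (linAvgIter k a) Y μ ν| ≤ ((P.L : ℝ) ^ k) ^ 2 * B := by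
  set Ld : ℝ := ((P.L : ℝ) ^ k) ^ P.d with hLd
  have hL0 : (0 : ℝ) < P.L := by exact_mod_cast P.L_pos
  have hLd0 : 0 < Ld := by rw [hLd]; positivity
  have hcard : (Fintype.card (Fin P.d → Fin (P.L ^ k)) : ℝ) = Ld := by
    rw [hLd, Fintype.card_fun, Fintype.card_fin, Fintype.card_fin]; push_cast; ring
  have hsq : ∀ r : Fin P.d → Fin (P.L ^ k), |rectSum a (bsite k Y r) μ ν (P.L ^ k) (P.L ^ k)| ≤ ((P.L ^ k : ℕ) : ℝ) * (P.L ^ k : ℕ) * B :=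
    fun r => abs_rectSum_le a (bsite k Y r) μ ν (P.L ^ k) (P.L ^ k) (fun s t hs ht => hB r s t hs ht)
  have hsum : |∑ r : Fin P.d → Fin (P.L ^ k), rectSum a (bsite k Y r) μ ν (P.L ^ k) (P.L ^ k)| ≤ Ld * (((P.L : ℝ) ^ k) ^ 2 * B) := by
    refine (Finset.abs_sum_le_sum_abs _ _).trans ?_
    calc ∑ r : Fin P.d → Fin (P.L ^ k), |rectSum a (bsite k Y r) μ ν (P.L ^ k) (P.L ^ k)|
        ≤ ∑ _r : Fin P.d → Fin (P.L ^ k), ((P.L ^ k : ℕ) : ℝ) * (P.L ^ k : ℕ) * B := Finset.sum_le_sum fun r _ => hsq r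
      _ = Ld * (((P.L : ℝ) ^ k) ^ 2 * B) := by
        rw [Finset.sum_const, Finset.card_univ, nsmul_eq_mul, hcard]; push_cast; ring
  rw [curlAt_linAvgIter_eq_sum_rectSum hk, abs_mul, abs_inv, abs_of_pos hLd0]
  calc Ld⁻¹ * |∑ r : Fin P.d → Fin (P.L ^ k), rectSum a (bsite k Y r) μ ν (P.L ^ k) (P.L ^ k)|
      ≤ Ld⁻¹ * (Ld * (((P.L : ℝ) ^ k) ^ 2 * B)) := mul_le_mul_of_nonneg_left hsum (inv_nonneg.mpr hLd0.le)
    _ = ((P.L : ℝ) ^ k) ^ 2 * B := by field_simp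

/-- ★ **A HEIGHT-`k` WINDOW IS A BOUND ON THE MEAN LEVEL-0 CURL**: if `|curlAt (linAvgIter k X) Y μ ν| ≤ c` then the mean of `curlAt X` over the
`(L^k)^d·(L^k)²` plaquettes of the translated-square family is `≤ c·(L^k)^{−2}` in absolute value (d = 3, `c = 2θ₀L^{k/2}π_k`: mean `≤ 2θ₀L^{−3k/2}π_k`).
[folklore] -/
theorem abs_mean_curlAt_le_of_window (hk : k ≤ P.m + P.K) (a : PBond P 0 → ℝ) (Y : Site P k) (μ ν : Fin P.d) {c : ℝ}
    (hc : |curlAt (linAvgIter k a) Y μ ν| ≤ c) :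
    |((((P.L : ℝ) ^ k) ^ P.d * ((P.L : ℝ) ^ k) ^ 2)⁻¹ *
        ∑ r : Fin P.d → Fin (P.L ^ k), ∑ t ∈ Finset.range (P.L ^ k), ∑ s ∈ Finset.range (P.L ^ k),
          curlAt a (shiftN (shiftN (bsite k Y r) ν t) μ s) μ ν)| ≤ c / ((P.L : ℝ) ^ k) ^ 2 := by
  have hL0 : (0 : ℝ) < P.L := by exact_mod_cast P.L_pos
  have hLd0 : 0 < ((P.L : ℝ) ^ k) ^ P.d := by positivity
  have hM0 : 0 < ((P.L : ℝ) ^ k) ^ 2 := by positivity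
  rw [sum_curlAt_eq_mul_curlAt_linAvgIter hk, abs_mul, abs_inv, abs_of_pos (mul_pos hLd0 hM0), abs_mul, abs_of_pos hLd0]
  have e : ((((P.L : ℝ) ^ k) ^ P.d * ((P.L : ℝ) ^ k) ^ 2))⁻¹ * ((((P.L : ℝ) ^ k) ^ P.d) * |curlAt (linAvgIter k a) Y μ ν|) =
      |curlAt (linAvgIter k a) Y μ ν| / ((P.L : ℝ) ^ k) ^ 2 := by
    field_simp
  rw [e]
  exact div_le_div_of_nonneg_right hc hM0.le

end Summit.QuantumFields.YangMills.Theorems.PoincareLipschitzLinAvgCurlClosedForm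

end
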